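import Literature.MathematicalPhysics.QuantumLattice.Imbrie2016.ScaleCovariance

/-!
# Imbrie (2016), Assumption LLA: the isotropic chain as the necessary core of the printed hypotheses

CITATION HEADER (lean-in-tree rule 2026-08-18). J. Z. Imbrie, *On many-body localization for quantum spin chains*,
J. Stat. Phys. **163** (2016) 998–1048, doi 10.1007/s10955-016-1508-x, arXiv:1403.7837 [ImbrieJSP2016], eq. (1.3) = (5.2)
(Assumption LLA(ν, C)), eq. (5.1) (Assumption A2(ν, ε₀)), §5 (the scales ε^{sϰn/n'} at which A2 is consumed).

WHAT IS PROVED (a lemma of the audit cell `pub-imbrie`, NOT a statement of the paper). Specialising the scale covariance of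
`ScaleCovariance.lean` to the target coupling γ' = 1: for admissible laws whose field and bond laws are dilation-dominated
(e.g. uniform on [-1, 1]),
* `LLA_isotropic_of_LLA`: LLA(γ; ν, C) at any coupling 0 < γ ≤ 1 implies LLA(1; ν, C γ⁻³) — the Hölder minimal-gap bound with
  the SAME exponent for the isotropic chain (h, J, Γ all of unit scale);
* `LLA_isotropic_of_A2`: the printed (5.1), A2(γ; ν, ε₀), with a threshold ε₀ at least the smallest scale the induction consumes,
  `ε₀ ≥ ε^{sϰ/m}` with `ε = γ^{1/20}` (the hypothesis under which `A2consumed_of_A2` derives the consumed form), and the harmless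
  arithmetic side condition `(1/20)(sϰ/m)ν ≤ 3`, implies LLA(1; ν, γ⁻³) as well;
* `LLA_isotropic_of_LLA_uniform`: the first statement with the dilation hypothesis discharged for uniform field/bond laws.
So every printed form of the hypothesis usable at a small coupling γ contains a statement about a chain with NO small parameter,
whereas the consumed form `A2consumed` does not transfer (pub-imbrie LLA.md gen-4 F5).

STATUS: elementary corollaries; says NOTHING about whether LLA or A2 holds. LLA for γ > 0 remains an OPEN, UNPROVED hypothesis of
Thm 1.1 (pub-imbrie LLA.md §7). No `sorry`, no new axioms, no new definitions.
-/

noncomputable section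
open _root_.MeasureTheory
open scoped ENNReal

namespace Literature.MathematicalPhysics.QuantumLattice.Imbrie2016

/-- LLA at a coupling `0 < γ ≤ 1` implies LLA for the isotropic chain `γ' = 1` with constant `C γ⁻³`
(dilation-dominated field and bond laws). [cite: ImbrieJSP2016, eq. (1.3)] -/
theorem LLA_isotropic_of_LLA {L : Laws} {ρ₀ : ℝ} (hL : L.Admissible ρ₀) {γ ν C : ℝ} (hγ : 0 < γ) (hγ1 : γ ≤ 1)
    (hν : 0 ≤ ν) (hC : 0 ≤ C)
    (hh : ∀ i, ∀ c : ℝ, 0 < c → c ≤ 1 → (L.μh i).map (fun x => c * x) ≤ ENNReal.ofReal c⁻¹ • L.μh i)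
    (hJ : ∀ i, ∀ c : ℝ, 0 < c → c ≤ 1 → (L.μJ i).map (fun x => c * x) ≤ ENNReal.ofReal c⁻¹ • L.μJ i)
    (hLLA : LLA L γ ν C) : LLA L 1 ν (C * (1 / γ) ^ 3) :=
  LLA_mono_coupling hL hγ hγ1 hν hC hh hJ hLLA

/-- The printed Assumption A2 = (5.1) at coupling `0 < γ ≤ 1`, with threshold `ε₀ ≥ ε^{sϰ/m}` (`ε = γ^{1/20}`; the hypothesis of
`A2consumed_of_A2`) and `(1/20)(sϰ/m)ν ≤ 3`, implies LLA for the isotropic chain with constant `γ⁻³`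
(dilation-dominated field and bond laws). [cite: ImbrieJSP2016, eq. (5.1), §5] -/
theorem LLA_isotropic_of_A2 {L : Laws} {ρ₀ : ℝ} (hL : L.Admissible ρ₀) {γ ν ε₀ s ϰ : ℝ} {m : ℕ}
    (hγ : 0 < γ) (hγ1 : γ ≤ 1) (hν : 0 ≤ ν)
    (hexp : (1 / 20 : ℝ) * (s * ϰ / m) * ν ≤ 3)
    (hε₀ : (γ ^ (1 / 20 : ℝ)) ^ (s * ϰ / m) ≤ ε₀)
    (hh : ∀ i, ∀ c : ℝ, 0 < c → c ≤ 1 → (L.μh i).map (fun x => c * x) ≤ ENNReal.ofReal c⁻¹ • L.μh i)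
    (hJ : ∀ i, ∀ c : ℝ, 0 < c → c ≤ 1 → (L.μJ i).map (fun x => c * x) ≤ ENNReal.ofReal c⁻¹ • L.μJ i)
    (hA2 : A2 L γ ν ε₀) : LLA L 1 ν ((1 / γ) ^ 3) := by
  have hb0 : 0 ≤ γ ^ (1 / 20 : ℝ) := Real.rpow_nonneg hγ.le _
  have he0 : 0 ≤ (γ ^ (1 / 20 : ℝ)) ^ (s * ϰ / m) := Real.rpow_nonneg hb0 _
  have hε₀0 : 0 ≤ ε₀ := le_trans he0 hε₀
  have hbig : (γ / 1) ^ 3 ≤ ε₀ ^ ν := by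
    rw [div_one]
    calc γ ^ 3 = γ ^ (3 : ℝ) := by rw [← Real.rpow_natCast]; norm_num
      _ ≤ γ ^ ((1 / 20 : ℝ) * (s * ϰ / m) * ν) := Real.rpow_le_rpow_of_exponent_ge hγ hγ1 hexp
      _ = ((γ ^ (1 / 20 : ℝ)) ^ (s * ϰ / m)) ^ ν := by rw [Real.rpow_mul hγ.le, Real.rpow_mul hγ.le]
      _ ≤ ε₀ ^ ν := Real.rpow_le_rpow he0 hε₀ hν
  exact LLA_of_A2_dilation hL hγ hγ1 hν hε₀0 hbig hh hJ hA2

/-- `LLA_isotropic_of_LLA` with the dilation hypothesis discharged: field and bond laws uniform on [-1, 1]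
(transverse-field laws arbitrary admissible). [cite: ImbrieJSP2016, eq. (1.3), p. 1000] -/
theorem LLA_isotropic_of_LLA_uniform {L : Laws} {ρ₀ : ℝ} (hL : L.Admissible ρ₀) {γ ν C : ℝ} (hγ : 0 < γ) (hγ1 : γ ≤ 1)
    (hν : 0 ≤ ν) (hC : 0 ≤ C)
    (hLh : ∀ i, L.μh i = ENNReal.ofReal 2⁻¹ • volume.restrict (Set.Icc (-1 : ℝ) 1))
    (hLJ : ∀ i, L.μJ i = ENNReal.ofReal 2⁻¹ • volume.restrict (Set.Icc (-1 : ℝ) 1))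
    (hLLA : LLA L γ ν C) : LLA L 1 ν (C * (1 / γ) ^ 3) :=
  LLA_isotropic_of_LLA hL hγ hγ1 hν hC
    (fun i c hc0 hc1 => by rw [hLh i]; exact uniformLaw_dilation hc0 hc1)
    (fun i c hc0 hc1 => by rw [hLJ i]; exact uniformLaw_dilation hc0 hc1) hLLA

end Literature.MathematicalPhysics.QuantumLattice.Imbrie2016
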